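import Summits.BirchSwinnertonDyer.BirchSwinnertonDyer.Theorems.ManinLocalTwoThreePinningKernelSieve
import HarnessLib

/-!
# The pinning kernel, part D: STAGED and CHUNKED sieve certificates

Cell `bsd-f2-manin`, route `ManinLocalTwoThree`, cruxes C2 `ManinOddAtFour` (stmt-BirchSwinnertonDyer-22967) and C3
`ManinPrimeToThreeAtNine` (stmt-BirchSwinnertonDyer-22968), an g54 (LENS analytic/periods); `--supports` either item (helper).
Generic, level-free supplement to `…PinningKernelSieve` (part A, in tree): at genus ≥ 7 the single kernel evaluation
`decide +kernel` of `∀ σ ∈ runSieve N K stages, σ ∈ cands` exhausts kernel memory (the live list of a stage is re-reduced inside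
the fold; measured at level 100: one stage of 77 live assignments × a box of 17 values fails, the whole fold fails).  The four
lemmas below let a level file certify the sieve ONE STAGE AT A TIME against script-emitted literal live lists
(`runSieve_subset_of_chain`: `sieveStep L_k stage_k ⊆ L_{k+1}` for all `k` gives `runSieve ⊆ L_s`) and a big stage CHUNK BY CHUNK
(`sieveStep_subset_of_chunks`: the live list is a concatenation of chunks, each chunk's output lies in `L_{k+1}`); each piece is
one small `decide +kernel`.  Pure list logic (monotonicity of `sieveStep` / of the fold in the live set); no curve, no modular form.
HONEST FRAMING: bookkeeping lemmas; nothing here proves C2/C3, Manin's conjecture or BSD.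
[cite: CremonaAlgorithms1997, §2.8, §2.10]
-/

set_option autoImplicit false
set_option linter.dupNamespace false

namespace Summit.BirchSwinnertonDyer.BirchSwinnertonDyer.Theorems.ManinLocalTwoThree.PinningKernel

/-- A sieve stage is monotone in the live set. [folklore] -/
theorem sieveStep_mono (N K : ℕ) {live live' : List (List (ℕ × ℤ))} (h : ∀ σ ∈ live, σ ∈ live')
    (st : ℕ × List (List ℤ)) : ∀ σ ∈ sieveStep N K live st, σ ∈ sieveStep N K live' st := by
  intro σ hσ
  simp only [sieveStep, List.mem_filter, List.mem_flatMap, List.mem_map] at hσ ⊢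
  obtain ⟨⟨τ, hτ, x, hx, rfl⟩, hok⟩ := hσ
  exact ⟨⟨τ, h τ hτ, x, hx, rfl⟩, hok⟩

/-- **CHUNKED STAGE CERTIFICATE.**  If the live list is the concatenation of `chunks` and every chunk's stage output lies
in `L'`, the stage output lies in `L'`. [folklore] -/
theorem sieveStep_subset_of_chunks (N K : ℕ) {live : List (List (ℕ × ℤ))} {st : ℕ × List (List ℤ)}
    {L' : List (List (ℕ × ℤ))} (chunks : List (List (List (ℕ × ℤ)))) (hcov : live = chunks.flatten)
    (h : ∀ j < chunks.length, ∀ σ ∈ sieveStep N K (chunks.getD j []) st, σ ∈ L') :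
    ∀ σ ∈ sieveStep N K live st, σ ∈ L' := by
  intro σ hσ
  subst hcov
  simp only [sieveStep, List.mem_filter, List.mem_flatMap, List.mem_map] at hσ
  obtain ⟨⟨τ, hτ, x, hx, rfl⟩, hok⟩ := hσ
  obtain ⟨c, hc, hτc⟩ := List.mem_flatten.mp hτ
  obtain ⟨j, hj, rfl⟩ := List.getElem_of_mem hc
  refine h j hj _ ?_
  simp only [sieveStep, List.mem_filter, List.mem_flatMap, List.mem_map, List.getD_eq_getElem _ _ hj]
  exact ⟨⟨_, hτc, x, hx, rfl⟩, hok⟩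

/-- A run of stages is monotone in the initial live set. [folklore] -/
theorem foldl_sieveStep_mono (N K : ℕ) : ∀ (stages : List (ℕ × List (List ℤ))) {live live' : List (List (ℕ × ℤ))},
    (∀ σ ∈ live, σ ∈ live') → ∀ σ ∈ stages.foldl (sieveStep N K) live, σ ∈ stages.foldl (sieveStep N K) live'
  | [], _, _, h => by simpa using h
  | st :: stages, _, _, h => by
    rw [List.foldl_cons, List.foldl_cons]
    exact foldl_sieveStep_mono N K stages (sieveStep_mono N K h st)

/-- **STAGED COVER CERTIFICATE.**  A chain of live lists `lvs = [L₁, …, L_s]`, one per stage, with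
`sieveStep L_k stage_k ⊆ L_{k+1}` (`L₀ = live`) covers the run: `stages.foldl sieveStep live ⊆ L_s`. [folklore] -/
theorem foldl_sieveStep_subset_of_chain (N K : ℕ) : ∀ (stages : List (ℕ × List (List ℤ))) (live : List (List (ℕ × ℤ)))
    (lvs : List (List (List (ℕ × ℤ)))), lvs.length = stages.length →
    (∀ k < stages.length, ∀ σ ∈ sieveStep N K ((live :: lvs).getD k []) (stages.getD k (0, [])), σ ∈ lvs.getD k []) →
    ∀ σ ∈ stages.foldl (sieveStep N K) live, σ ∈ (live :: lvs).getD stages.length []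
  | [], live, lvs, _, _ => by simp
  | st :: stages, live, [], h, _ => by simp at h
  | st :: stages, live, L :: lvs, hlen, hch => by
    intro σ hσ
    rw [List.foldl_cons] at hσ
    have h0 : ∀ σ ∈ sieveStep N K live st, σ ∈ L := by simpa using hch 0 (by simp)
    have ih := foldl_sieveStep_subset_of_chain N K stages L lvs (by simpa using hlen)
      (fun k hk ↦ by simpa using hch (k + 1) (by simpa using hk))
    simpa using ih σ (foldl_sieveStep_mono N K stages h0 σ hσ)

/-- **The staged cover of a run**: with `L₀ = [[]]`, `runSieve N K stages ⊆ L_s`. [folklore] -/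
theorem runSieve_subset_of_chain (N K : ℕ) (stages : List (ℕ × List (List ℤ))) (lvs : List (List (List (ℕ × ℤ))))
    (hlen : lvs.length = stages.length)
    (hch : ∀ k < stages.length, ∀ σ ∈ sieveStep N K (([[]] :: lvs).getD k []) (stages.getD k (0, [])), σ ∈ lvs.getD k []) :
    ∀ σ ∈ runSieve N K stages, σ ∈ ([[]] :: lvs).getD stages.length [] :=
  foldl_sieveStep_subset_of_chain N K stages [[]] lvs hlen hch

end Summit.BirchSwinnertonDyer.BirchSwinnertonDyer.Theorems.ManinLocalTwoThree.PinningKernel
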